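import Literature.Analysis.FluidPDE.AxisymmetricEuler
import Literature.Analysis.FluidPDE.NSWave0
import Literature.Analysis.FluidPDE.SuitableWeak
import HarnessLib

/-!
# Chen–Strain–Yau–Tsai 2008: Hölder continuity at the axis for the drift–diffusion equation of `Γ = r v_θ`

Reproduction of a PUBLISHED statement as a named fact (statement only, no proof).

**Source.** C.-C. Chen, R. M. Strain, H.-T. Yau, T.-P. Tsai, *Lower bound on the blow-up rate of the
axisymmetric Navier–Stokes equations*, Int. Math. Res. Not. 2008 (doi 10.1093/imrn/rnn016,
arXiv:math/0701796), §3, Theorem 3.1 (numbered "Theorem 4" in the arXiv version). What is reproduced: the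
statement of that theorem, in classical (smooth) form, as the `Prop`-valued named fact
`driftHolderAtAxis_CSTY2008`.

**Informal statement.** Let `Γ(x,t)` be a smooth bounded solution of
`∂ₜ Γ + b·∇Γ − ΔΓ + (2/r) ∂ᵣ Γ = 0` in the parabolic cylinder `Q₂ = {|x| < 2, −4 < t < 0} ⊂ ℝ³ × ℝ`, with
smooth drift `b` (neither `Γ` nor `b` needs to be axisymmetric), and assume `Γ|_{r=0} = 0`, `div b = 0` and
`|b| ≤ C_*/r` in `Q₂`, where `r` is the distance to the `x₂`-axis. Then there are constants `C` and `α > 0`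
depending only on `C_*` such that `|Γ(x,t)| ≤ C ‖Γ‖_{L^∞(Q₂)} r^α` in `Q₁ = {|x| < 1, −1 < t < 0}`.
This is the equation satisfied by `Γ = r v_θ` for an axisymmetric Navier–Stokes velocity `v` with drift
`b = v_r e_r + v_z e_z` (CSTY 2008, §3, the displayed equation before Theorem 3.1), and the theorem is the
passive-scalar engine behind the Type I axisymmetric regularity results (`knss_no_axisymmetric_typeI` in
`Axisymmetric.lean`): at the scale-critical drift size `|b| ≤ C_*/r` the swirl `Γ` keeps a Hölder modulus at
the axis, with NO smallness assumption on `C_*`.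

**Design choices.**
* Functions are time-first, `Γ : ℝ → ℝ³ → ℝ`, `b : ℝ → ℝ³ → ℝ³`, as everywhere in this directory; the cylinders
  are the accepted `parabolicCylinder R 0 = (−R², 0) × B_R(0)` of `SuitableWeak.lean` (CSTY's `Q(R) = Q(R,1)`).
* "Smooth in `Q₂`" is `ContDiffOn ℝ ∞` of the uncurried map on the open set `Q₂`; the time derivative is the
  plain `deriv` of the time slice (interior points).
* The equation is imposed pointwise on `Q₂ ∩ {r ≠ 0}`, where the coefficient `2/r` is finite. For smooth `Γ`
  this is equivalent to the equation in `𝒟'(Q₂)`, because `(2/r) ∂ᵣΓ` is locally integrable across the axis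
  (no measure can concentrate on the codimension-2 axis); the printed hypothesis "solution in `Q₂`" is thus
  rendered faithfully and junk-free. `∂ᵣ Γ = e_r · ∇Γ` uses the accepted radial unit vector `eR`
  (`AxisymmetricEuler.lean`), `b·∇Γ` is `fderiv ℝ (Γ t) x (b t x)`, `ΔΓ` is Mathlib's Laplacian, `div b` is
  `NSWave0.divergence`.
* The drift bound is the junk-free product form `r ‖b‖ ≤ C_*` (no division; vacuous content on the axis, as in
  print — `b` is smooth there anyway).
* `‖Γ‖_{L^∞(Q₂)}` is replaced by an arbitrary pointwise bound `M` on `Q₂`; since the conclusion is monotone in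
  `M` this is equivalent to the printed sup-norm form and avoids `essSup`.
* `r^α` is the real power of the nonnegative `cylRadius x` (`0^α = 0` for `α > 0`, consistent with `Γ|_{r=0} = 0`).
* No sign condition on `C_*` is imposed (for `C_* < 0` the hypotheses force `Q₂ = ∅`-like vacuity only off the
  axis; the statement is then trivially weaker than the `C_* = 0` case and still true).

Deliberately NOT here: the weak/energy-class version, the De Giorgi–Moser machinery of the proof (§3.1–3.3), and
the Navier–Stokes corollaries (Theorems 1.1–1.2 of the paper), which are `knss_no_axisymmetric_typeI`.
-/

open scoped ContDiff
open Laplacian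

namespace Literature.Analysis.FluidPDE

noncomputable section

local notation "ℝ³" => EuclideanSpace ℝ (Fin 3)

/-- **Chen–Strain–Yau–Tsai 2008, Theorem 3.1** (arXiv version: Theorem 4), as a named fact.
For every `C_*` there are `C` and `α > 0` such that: whenever `Γ : ℝ → ℝ³ → ℝ` and `b : ℝ → ℝ³ → ℝ³` are
smooth on `Q₂ = parabolicCylinder 2 0 = (−4,0) × B₂(0)`, `Γ = 0` on the axis `{r = 0}`, `div b = 0`,
`r‖b‖ ≤ C_*` in `Q₂`, and `∂ₜΓ + b·∇Γ − ΔΓ + (2/r) eᵣ·∇Γ = 0` at every point of `Q₂` off the axis, then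
every bound `|Γ| ≤ M` on `Q₂` gives `|Γ(t,x)| ≤ C · M · r(x)^α` on `Q₁ = parabolicCylinder 1 0`.
Users take it as a hypothesis `(h : driftHolderAtAxis_CSTY2008)`. [cite: ChenStrainYauTsai2008, §3 Thm 3.1 (arXiv: Thm 4)] -/
def driftHolderAtAxis_CSTY2008 : Prop :=
  ∀ Cstar : ℝ, ∃ C α : ℝ, 0 < α ∧
    ∀ (Γ : ℝ → ℝ³ → ℝ) (b : ℝ → ℝ³ → ℝ³),
      ContDiffOn ℝ ∞ (Function.uncurry Γ) (parabolicCylinder 2 (0 : ℝ × ℝ³)) →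
      ContDiffOn ℝ ∞ (Function.uncurry b) (parabolicCylinder 2 (0 : ℝ × ℝ³)) →
      (∀ p ∈ parabolicCylinder 2 (0 : ℝ × ℝ³), cylRadius p.2 = 0 → Γ p.1 p.2 = 0) →
      (∀ p ∈ parabolicCylinder 2 (0 : ℝ × ℝ³), NSWave0.divergence (b p.1) p.2 = 0) →
      (∀ p ∈ parabolicCylinder 2 (0 : ℝ × ℝ³), cylRadius p.2 * ‖b p.1 p.2‖ ≤ Cstar) →
      (∀ p ∈ parabolicCylinder 2 (0 : ℝ × ℝ³), cylRadius p.2 ≠ 0 →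
        deriv (fun s => Γ s p.2) p.1 + fderiv ℝ (Γ p.1) p.2 (b p.1 p.2) - (Δ (Γ p.1)) p.2
          + 2 / cylRadius p.2 * fderiv ℝ (Γ p.1) p.2 (eR p.2) = 0) →
      ∀ M : ℝ, (∀ p ∈ parabolicCylinder 2 (0 : ℝ × ℝ³), |Γ p.1 p.2| ≤ M) →
        ∀ p ∈ parabolicCylinder 1 (0 : ℝ × ℝ³), |Γ p.1 p.2| ≤ C * M * cylRadius p.2 ^ α

/-- Sanity check of the shape of the fact (not of its truth): the static profile `Γ = r²`, `b = 0` is a smooth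
bounded solution of the equation vanishing on the axis (`Δ r² = 4 = (2/r)∂ᵣ r²`), and for it the conclusion
holds with `C = 1`, `α = 2`, `M = 4`: on `Q₁` one has `r² ≤ 1 · 4 · r²`. Recorded only as the trivial real
inequality it reduces to. [folklore] -/
theorem driftHolderAtAxis_CSTY2008_shape_example (r : ℝ) : r ^ 2 ≤ 1 * 4 * r ^ (2 : ℝ) := by
  rw [Real.rpow_two]
  nlinarith [sq_nonneg r]

end

end Literature.Analysis.FluidPDE
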